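import Mathlib
import Literature.AlgebraicGeometry.Resolution.KnafKuhlmann2005Thm34Stability
import Literature.AlgebraicGeometry.Resolution.GeneralizedStabilityHolds
import HarnessLib

/-!
# Knaf–Kuhlmann 2005, Thm. 3.4 (a)+(c) for a `K`-trivial Abhyankar place: the Hensel-root presentation over a torus whose values GENERATE `v F`

Route `RadicialJung`, crux `CleanModels` (stmt-ResolutionOfSingularities-15917), line `Sketch` rev 35; explicit-unit seat `decomp-res-hand-1` g3.
GROUNDWORK (the «M1 inside Thm. 3.4» step of `Cruxes/CleanModels/Lines/Sketch-memo-hand1-g3.md` §4) for the discharge of the printed input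
`Literature.AlgebraicGeometry.Resolution.KnafKuhlmann2005_Thm11_monomialForm` (Knaf–Kuhlmann 2005, Thm. 1.1 WITH its monomial clause).
The tree's PROVED `KnafKuhlmann2005_Thm34_henselRoot` (`KnafKuhlmann2005Thm34Stability.lean`, from the Generalized Stability Theorem
`Kuhlmann2010Stability_holds`) renders Thm. 3.4 with clause (a) WEAKENED to «the values of `x₁,…,x_ρ` are ℤ-independent»; the printed clause
(a) is «`v_P F = v_P K ⊕ ℤ v_P x₁ ⊕ … ⊕ ℤ v_P x_ρ`», i.e. the values also GENERATE — and this is exactly what Knaf–Kuhlmann's bookkeeping for the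
«Moreover» (monomial) clause of Thm. 1.1 uses (p. 13: `v ζ = v(x^m)`, `u_ζ := ζ / x^m` a unit).  The tree's proof already constructs an ADAPTED
Abhyankar basis with generating values (`exists_adapted_isAbhyankarBasis`, conclusion `Subgroup.closure … = ⊤`) and merely forgets it when reading the
data back in `Ω`.  This file re-runs that proof verbatim (same lemmas, same order) and keeps the clause:

* `thm34_henselRoot_gen` — for `F = K(s₀) ⊆ Ω` finitely generated over `K` (the hypothesis `K ≤ F` of the fact is not needed), `K ⊆ 𝒪_V`, `V` Abhyankar on `F|K` with `FP|KP` separably generated: `x, y, η, f` as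
  in `KnafKuhlmann2005_Thm34_henselRoot` AND `∀ a ∈ F, a ≠ 0 → ∃ m : Fin ρ → ℤ, v a = ∏ v(xᵢ)^{mᵢ}`.

OURS (a one-clause strengthening of a landed proof; the mathematics is Knaf–Kuhlmann's Thm. 3.4 (a)); proves nothing about resolution of
singularities in characteristic `p`. counted 0.
-/

noncomputable section

set_option linter.dupNamespace false -- mandated namespace of this single-conjunct summit

open IsLocalRing ValuationSubring Polynomial Cardinal
open scoped IntermediateField
open Literature.AlgebraicGeometry.Resolution

namespace Summit.ResolutionOfSingularities.ResolutionOfSingularities.Theorems.RadicialJung.CleanModels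

namespace KK05ValueBasis

universe u

variable {Ω : Type u} [Field Ω]

/-- **Knaf–Kuhlmann 2005, Thm. 3.4 for a `K`-trivial Abhyankar place, Hensel-root form, WITH clause (a) in full** ("`v_P F = v_P K ⊕ ℤv_P x₁ ⊕
… ⊕ ℤv_P x_ρ`": the values of the `xᵢ` are ℤ-independent AND generate the values of `F ∖ 0`, `K` being trivially valued), together with `y` (residues
algebraically independent over `KP`), a generator `η ∈ 𝒪_V` of `F` over `K(x, y)` and a monic `f` over `𝒪_{K(x,y)}` with `f(η) = 0`, `v(f'(η)) = 1`.
Proof = the tree's `KnafKuhlmann2005_Thm34_henselRoot.of_stability` verbatim (adapted Abhyankar basis `exists_adapted_isAbhyankarBasis`, inertial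
generator `Temkin2013_Thm551iii_inertial.of_stability` over `Kuhlmann2010Stability_holds`), keeping the generation clause of the adapted basis.
[cite: KnafKuhlmann2005, Thm. 3.4 and its proof (p. 7)] -/
theorem thm34_henselRoot_gen (V : ValuationSubring Ω) (K F : Subfield Ω) (hfg : FGOver K F)
    (hKV : (K : Set Ω) ⊆ V) (hA : IsAbhyankarPlace V K F) (hsep : SeparablyGeneratedOver (resField V K) (resField V F)) :
    ∃ (ρ τ : ℕ) (x : Fin ρ → Ω) (y : Fin τ → Ω) (hy : ∀ j, y j ∈ V),
      (∀ i, x i ∈ F ∧ x i ≠ 0) ∧ (∀ j, y j ∈ F) ∧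
      (∀ m : Fin ρ → ℤ, (∃ b ∈ K, (∏ i, V.valuation (x i) ^ (m i)) = V.valuation b) → m = 0) ∧
      (∀ a ∈ F, a ≠ 0 → ∃ m : Fin ρ → ℤ, V.valuation a = ∏ i, V.valuation (x i) ^ (m i)) ∧
      AlgebraicIndependent (resField V K) (fun j => residue V ⟨y j, hy j⟩) ∧
      ∃ η ∈ V, ∃ f : Polynomial Ω,
        Subfield.closure ((Subfield.closure ((K : Set Ω) ∪ (Set.range x ∪ Set.range y)) : Set Ω)
          ∪ {η}) = F ∧
        f.Monic ∧
        (∀ k, f.coeff k ∈ V ∧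
          f.coeff k ∈ Subfield.closure ((K : Set Ω) ∪ (Set.range x ∪ Set.range y))) ∧
        f.eval η = 0 ∧ V.valuation ((Polynomial.derivative f).eval η) = 1 := by
  classical
  -- `F` as an intermediate field `M` of `Ω|K`, and `O := O_V ∩ M`
  obtain ⟨s₀, hs₀⟩ := hfg
  set M : IntermediateField K Ω := IntermediateField.adjoin K (s₀ : Set Ω) with hM
  have hMF : ∀ z : Ω, z ∈ M ↔ z ∈ F := fun z => by
    rw [hM, mem_adjoin_subfield_iff, hs₀]
  have hfgM : (⊤ : IntermediateField K M).FG :=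
    IntermediateField.fg_top_iff.mpr
      (IntermediateField.essFiniteType_iff.mpr (IntermediateField.fg_adjoin_finset s₀))
  have hk : ∀ c : K, algebraMap K M c ∈ V.comap (algebraMap M Ω) :=
    algebraMap_mem_comap_intermediateField V M hKV
  have hKV' : ∀ c : K, algebraMap K Ω c ∈ V := algebraMap_subfield_mem_of_subset V hKV
  set O := V.comap (algebraMap M Ω) with hO
  have hD : transcendenceDefect K O hk = 0 :=
    transcendenceDefect_comap_eq_zero_of_isAbhyankarPlace V M hMF hKV hfgM hA
  letI := algebraOfMem K O hk
  letI := algebraOfMem K V hKV'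
  -- a separating transcendence basis of the residue field, an adapted Abhyankar basis, and the
  -- Hensel-root generator
  obtain ⟨s, hs, hseps⟩ :=
    exists_isTranscendenceBasis_residueField_of_separablyGeneratedOver V M hMF hKV hsep
  obtain ⟨E, x, y, hB, hgen, hyrange⟩ := exists_adapted_isAbhyankarBasis O hk hfgM hD s hs
  have hsep' : ∀ z : ResidueField O,
      IsSeparable (IntermediateField.adjoin K (Set.range fun i => residue O (y i))) z := by
    have key : ∀ S : Set (ResidueField O), S = (s : Set (ResidueField O)) →
        ∀ z : ResidueField O, IsSeparable (IntermediateField.adjoin K S) z := by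
      rintro S rfl; exact hseps
    exact key _ hyrange
  obtain ⟨η, hηO, htop, f, hfm, hfη, hcoef, -, hder⟩ :=
    Temkin2013_Thm551iii_inertial.of_stability Kuhlmann2010Stability_holds K M hfgM O hk hD E s.card x y hB hgen hsep'
  -- the data read in `Ω`
  set x' : Fin E → Ω := fun i => (x i : Ω) with hx'
  set y' : Fin s.card → Ω := fun j => ((y j : M) : Ω) with hy'
  have hy'V : ∀ j, y' j ∈ V := fun j => ValuationSubring.mem_comap.mp (y j).2
  have hx'0 : ∀ i, x' i ≠ 0 := fun i h =>
    hB.ne_zero i ((map_eq_zero_iff _ (algebraMap M Ω).injective).mp h)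
  -- images of the adjunctions
  have himg : Subtype.val '' Set.range (Sum.elim x fun i => (y i : M)) =
      Set.range x' ∪ Set.range y' := by
    rw [← Set.range_comp, Sum.comp_elim, Set.Sum.elim_range]
    rfl
  have himgη : Subtype.val '' (Set.range (Sum.elim x fun i => (y i : M)) ∪ {η}) =
      Set.range x' ∪ Set.range y' ∪ {(η : Ω)} := by
    rw [Set.image_union, himg, Set.image_singleton]
  have hadjη : IntermediateField.adjoin K (Set.range x' ∪ Set.range y' ∪ {(η : Ω)}) = M := by
    rw [← himgη, ← IntermediateField.lift_adjoin, htop, IntermediateField.lift_top]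
  have heval : ∀ p : Polynomial M, (p.map (algebraMap M Ω)).eval (η : Ω) =
      algebraMap M Ω (p.eval η) := fun p => by
    rw [Polynomial.eval_map]
    exact Polynomial.eval₂_hom (algebraMap M Ω) η
  refine ⟨E, s.card, x', y', hy'V, fun i => ⟨(hMF _).mp (x i).2, hx'0 i⟩,
    fun j => (hMF _).mp (y j : M).2, ?_, ?_, ?_, (η : Ω), ValuationSubring.mem_comap.mp hηO,
    f.map (algebraMap M Ω), ?_, hfm.map _, fun k => ?_, ?_, ?_⟩
  · -- `ℤ`-independence of the values modulo `vK = 1`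
    have hvi : IsValueIndependent V x' :=
      (isValueIndependent_comap_iff V x).mp
        ((isValueIndependent_iff_linearIndependent O x hB.ne_zero).mpr hB.linearIndependent)
    rintro m ⟨b, hbK, hb⟩
    have hb0 : b ≠ 0 := by
      rintro rfl
      rw [map_zero] at hb
      exact (Finset.prod_ne_zero_iff.mpr fun i _ =>
        zpow_ne_zero _ (valuation_ne_zero_of_ne_zero V (hx'0 i))) hb
    have hb1 : V.valuation b = 1 :=
      valuation_eq_one_of_subfield_subset V (F := K) (fun z hz => hKV hz) hbK hb0
    have hprod : V.valuation (∏ i ∈ Finset.univ, x' i ^ m i) = 1 := by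
      rw [map_prod]
      simp_rw [map_zpow₀]
      rw [hb, hb1]
    funext i
    exact hvi.2 Finset.univ m hprod i (Finset.mem_univ i)
  · -- the values of the `xᵢ` GENERATE the value group (Thm. 3.4 (a)): from `hgen`
    intro a haF ha0
    have haM : a ∈ M := (hMF a).mpr haF
    set a' : M := ⟨a, haM⟩ with ha'
    have ha'0 : a' ≠ 0 := fun h => ha0 (congrArg Subtype.val h)
    have hva'0 : O.valuation a' ≠ 0 := (map_ne_zero O.valuation).mpr ha'0
    have hmem : Units.mk0 (O.valuation a') hva'0 ∈ Subgroup.closure (Set.range fun j =>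
        Units.mk0 (O.valuation (x j)) (valuation_ne_zero_of_ne_zero O (hB.ne_zero j))) := by
      rw [hgen]; exact Subgroup.mem_top _
    obtain ⟨m, hm⟩ := Subgroup.mem_closure_range_iff_of_fintype.mp hmem
    refine ⟨m, ?_⟩
    -- `a' / x^m` is a unit of `O`, read in `Ω`
    have hq : O.valuation (a' / ∏ j, x j ^ m j) = 1 := by
      rw [map_div₀, map_prod]
      simp_rw [map_zpow₀]
      have h1 : O.valuation a' = ∏ j, O.valuation (x j) ^ m j := by
        have := congrArg (fun u : (O.ValueGroup)ˣ => (u : O.ValueGroup)) hm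
        simpa only [Units.val_mk0, Units.coe_prod, Units.val_zpow_eq_zpow_val] using this
      rw [h1, div_self]
      exact Finset.prod_ne_zero_iff.mpr fun j _ => zpow_ne_zero _ (valuation_ne_zero_of_ne_zero O (hB.ne_zero j))
    have hq' := (valuation_comap_eq_one_iff V _).mp hq
    have hxx : ∀ j, (algebraMap M Ω) (x j) = x' j := fun j => rfl
    have haa : (algebraMap M Ω) a' = a := rfl
    simp only [map_div₀, map_prod, map_zpow₀, hxx, haa] at hq'
    have hP0 : (∏ j, V.valuation (x' j) ^ m j) ≠ 0 :=
      Finset.prod_ne_zero_iff.mpr fun j _ => zpow_ne_zero _ (valuation_ne_zero_of_ne_zero V (hx'0 j))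
    exact (div_eq_one_iff_eq hP0).mp hq'
  · -- algebraic independence of the residues over `KP`
    let ψ := residueFieldComapAlgHom K V hKV' hk
    have h1 : AlgebraicIndependent K fun i => residue O (y i) := hB.algebraicIndependent_residue
    have h2 : AlgebraicIndependent K (⇑ψ ∘ fun i => residue O (y i)) :=
      h1.map ψ.toRingHom.injective.injOn
    have h3 : (⇑ψ ∘ fun i => residue O (y i)) = fun j => residue V ⟨y' j, hy'V j⟩ := by
      funext j
      simp only [Function.comp_apply]
      rw [residueFieldComapAlgHom_residue]
      rfl
    obtain ⟨φ, -, hφs, hφ, -⟩ := exists_residue_ringHoms V K (F := K) le_rfl (fun z hz => hKV hz)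
    have hφcomp : (algebraMap (resField V K) (ResidueField V)).comp φ =
        (RingHom.id _).comp (algebraMap K (ResidueField V)) := RingHom.ext fun c => hφ c
    have h4 := h2.ringHom_of_comp_eq φ (RingHom.id _) hφs (RingHom.id _).injective hφcomp
    rwa [RingHom.coe_id, Function.id_comp, h3] at h4
  · -- `F = K(x', y')(η)`
    rw [Subfield.closure_closure_union, Set.union_assoc]
    ext z
    rw [← mem_adjoin_subfield_iff, hadjη]
    exact hMF z
  · -- coefficients in `O_V ∩ K(x', y')`
    rw [Polynomial.coeff_map]
    refine ⟨ValuationSubring.mem_comap.mp (hcoef k).2, ?_⟩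
    rw [← mem_adjoin_subfield_iff, ← himg, ← IntermediateField.lift_adjoin]
    exact (IntermediateField.mem_lift (f.coeff k)).mpr (hcoef k).1
  · -- `f(η) = 0`
    rw [heval, hfη, map_zero]
  · -- `v(f'(η)) = 1`
    rw [Polynomial.derivative_map, heval]
    exact (valuation_comap_eq_one_iff V _).mp hder

end KK05ValueBasis

end Summit.ResolutionOfSingularities.ResolutionOfSingularities.Theorems.RadicialJung.CleanModels

end
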